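import Mathlib
import Summits.ValiantsHypothesis.ValiantsHypothesis.Statement
import Summits.ValiantsHypothesis.ValiantsHypothesis.Theorems.SoloInformedPencilPair
import HarnessLib

/-!
# Pencil girth — the first non-additive inequality for univariate realisations (soloist, s35)

All previous `SoloInformed*Girth` files bound the number of monomials `X^e` realisable from a
subspace `W ⊂ F[X]` (`dim W = s`) by **additive** bookkeeping (sumset girth, ray/jet budgets):
they never use that two multipliers `q_a`, `q_b` *commute*.  This file proves the first
inequality that does.

**Setting (the star / pencil template u76).**  Hubs `q_a`, `a ∈ B`, all act on the same
subspace `W`; hub `a` realises the monomials `X^e`, `e ∈ E_a`, on its pencil: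
`q_a · x_{a,e} = w_{a,e} + X^e` with `x_{a,e}, w_{a,e} ∈ W`.  The value sets `E_a` are pairwise
disjoint, `E = ⋃ E_a` is `(K,h)`-free (`K ≥ 4`, `h ≥ 1`, which makes `E` a Sidon set for the
purposes below), and (per hub) `W` contains no nonzero polynomial supported on `E_a` — a
normalisation that the companion file `SoloInformedPencilGirthFree` removes at the cost of
replacing `|E_a|` by `|E_a| − dim(W ∩ T_{E_a})` on the left.

**Theorem `soloInformed_pencilGirth`.**
`Σ_{a<b} C(|E_a| + |E_b| − s, 2) ≤ s² + s·Σ_a |E_a|`.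

*Proof.*  For a pair `a < b` let `P_{ab} = {(c,d) : ξ_a(c) = ξ_b(d)}` be the fibre product of the
leaf maps (`ξ_a(c) = Σ c_e x_{a,e}`), of dimension `m ≥ |E_a| + |E_b| − s`.  Commuting `q_a`
past `q_b` on `ξ_a(c) = ξ_b(d)` gives, for two elements `(c,d), (c′,d′)` of `P_{ab}`, the
*wedge identity* `Λ_a(c)Λ_b(d′) − Λ_a(c′)Λ_b(d) ∈ Z := W·W + T_E·W` (`Λ_a(c) = Σ c_e X^e`),
a space of dimension `≤ s² + s|E|`.  The `C(m,2)` wedges of a basis of `P_{ab}` are linearly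
independent (leading-monomial argument on the Sidon grid `E_a + E_b`, `solo_linearIndependent_wedge`),
supported on `E_a + E_b`, and the grids of distinct pairs are disjoint (Sidon again); summing
over pairs gives the bound (`solo_pencil_pair` + `linearIndependent_iUnion_finite`).

**Corollary `soloInformed_pencilGirth_few`.**  If every hub carries at least `(s+d)/2` and at
most `R` values then `C(|B|,2)·C(d,2) ≤ s² + s|B|R`; with `d = 2δs`, `R = O(s)` this is
`|B| = O(δ⁻²)`: a common-line pencil configuration has only `O(δ⁻²)` hubs carrying more than
`(1/2+δ)s` values each.

**Path to the summit and honest scope.**  The summit reduction in force is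
`soloInformed_valiantsHypothesis_of_unipolyLogOrderBound` (order bound `|E| ≤ C s^γ`, `γ < 3/2`,
for free realised value sets).  The extremal configurations against the additive tools were
stars of pencils on one subspace with `≍ s` values per hub; this file caps the values per hub at
`(1/2+o(1))s` once there are `ω(1)` hubs — a constant factor, not an exponent.  It does **not**
prove `hQ`: (a) *half pencils* (`≤ s/2` values per hub, pairwise transversal leaf spans, so every
fibre product `P_{ab}` vanishes) are untouched; (b) pencils through *different* lines
(`p_a ≠ p_b`) produce pair-dependent target spaces `p_a p_b·D(W) + p_a q_b·D(W) + q_a p_b·D(W)`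
and the summation over pairs gains nothing; (c) blocks that are not pencils are untouched; the
exponent `3/2` is not moved.  The residual adversary is re-typed accordingly in the soloist
dossier (quadspan §2.70: questions u77 = half pencils, u78 = multi-line stars).
-/

namespace Summit.ValiantsHypothesis.ValiantsHypothesis.Theorems

open Finset Polynomial Module
open scoped Pointwise

/-! ### The pencil girth theorem -/

/-- **Pencil girth bound** (soloist, s35 §3d, Theorem A).  `W ⊂ F[X]` a subspace of dimension
`s`; hubs `q a` (`a ∈ B`) with pairwise disjoint value sets `E a`; every `X^e`, `e ∈ E a`, lies
on the pencil `W + q_a W` (`q a * x = w + X^e` with `x, w ∈ W`); `⋃ E a` is `(K,h)`-free with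
`K ≥ 4`, `h ≥ 1`; and, for each hub `a`, `W` contains no nonzero polynomial supported on `E a`
(this per-hub hypothesis is removed altogether in `SoloInformedPencilGirthFree`).  Then
`Σ_{a<b} C(|E a| + |E b| - s, 2) ≤ s² + s Σ_a |E a|`. -/
theorem soloInformed_pencilGirth {F : Type*} [Field F] {ι : Type*} [LinearOrder ι]
    (B : Finset ι) (W : Submodule F F[X]) [FiniteDimensional F W] (q : ι → F[X])
    (E : ι → Finset ℕ) {K h : ℕ} (hK : 4 ≤ K) (hh : 1 ≤ h)
    (hfree : SoloNatFree K h (B.biUnion E))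
    (hdisj : ∀ a ∈ B, ∀ b ∈ B, a ≠ b → Disjoint (E a) (E b))
    (hW : ∀ a ∈ B, ∀ f ∈ W, (∀ k ∉ E a, f.coeff k = 0) → f = 0)
    (hreal : ∀ a ∈ B, ∀ e ∈ E a, ∃ x ∈ W, ∃ w ∈ W, q a * x = w + X ^ e) :
    ∑ p ∈ B.offDiag with p.1 < p.2, ((E p.1).card + (E p.2).card - finrank F W).choose 2
      ≤ finrank F W ^ 2 + finrank F W * ∑ a ∈ B, (E a).card := by
  classical
  choose! x hxW w hwW hqx using hreal
  set s := finrank F W with hs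
  set bW := Module.finBasis F W with hbW
  set bWf : Finset F[X] := Finset.univ.image (fun i => (bW i : F[X])) with hbWf
  set Mf : Finset F[X] := (B.biUnion E).image (fun e => (X : F[X]) ^ e) with hMf
  set N : Submodule F F[X] := Submodule.span F (Mf : Set F[X]) with hN
  set Z : Submodule F F[X] :=
    Submodule.span F ((bWf * bWf ∪ Mf * bWf : Finset F[X]) : Set F[X]) with hZ
  -- `W ⊆ span bWf`, hence the product memberships
  have hWspan : W ≤ Submodule.span F (bWf : Set F[X]) := by
    intro y hy
    have hrepr := congrArg Subtype.val (bW.sum_repr ⟨y, hy⟩)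
    simp only [Submodule.coe_sum, Submodule.coe_smul] at hrepr
    rw [← hrepr]
    exact Submodule.sum_mem _ fun i _ => Submodule.smul_mem _ _
      (Submodule.subset_span (by simp [hbWf]))
  have hZ1 : ∀ y ∈ W, ∀ y' ∈ W, y * y' ∈ Z := by
    intro y hy y' hy'
    have : y * y' ∈ Submodule.span F (bWf : Set F[X]) * Submodule.span F (bWf : Set F[X]) :=
      Submodule.mul_mem_mul (hWspan hy) (hWspan hy')
    rw [Submodule.span_mul_span, ← Finset.coe_mul] at this
    exact Submodule.span_mono (Finset.coe_subset.mpr Finset.subset_union_left) this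
  have hZ2 : ∀ τ ∈ N, ∀ y ∈ W, τ * y ∈ Z := by
    intro τ hτ y hy
    have : τ * y ∈ Submodule.span F (Mf : Set F[X]) * Submodule.span F (bWf : Set F[X]) :=
      Submodule.mul_mem_mul hτ (hWspan hy)
    rw [Submodule.span_mul_span, ← Finset.coe_mul] at this
    exact Submodule.span_mono (Finset.coe_subset.mpr Finset.subset_union_right) this
  have hXN : ∀ a ∈ B, ∀ e ∈ E a, (X : F[X]) ^ e ∈ N := fun a ha e he =>
    Submodule.subset_span (Finset.mem_coe.mpr
      (Finset.mem_image.mpr ⟨e, Finset.mem_biUnion.mpr ⟨a, ha, he⟩, rfl⟩))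
  have hdisj' : ∀ a ∈ B, ∀ b ∈ B, ∀ u, u ∈ E a → u ∈ E b → a = b := by
    intro a ha b hb u hua hub
    by_contra hne
    exact Finset.disjoint_left.mp (hdisj a ha b hb hne) hua hub
  have hmemU : ∀ a ∈ B, ∀ u ∈ E a, u ∈ B.biUnion E := fun a ha u hu =>
    Finset.mem_biUnion.mpr ⟨a, ha, hu⟩
  -- Sidon inside one pair of hubs
  have hSin : ∀ a ∈ B, ∀ b ∈ B, a ≠ b → ∀ u ∈ E a, ∀ u' ∈ E b, ∀ v ∈ E a, ∀ v' ∈ E b,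
      u + u' = v + v' → u = v := by
    intro a ha b hb hab u hu u' hu' v hv v' hv' hsum
    have huu' : u ≠ u' := fun h => hab (hdisj' a ha b hb u hu (h ▸ hu'))
    have hvv' : v ≠ v' := fun h => hab (hdisj' a ha b hb v hv (h ▸ hv'))
    rcases hfree.sidon hK hh (hmemU a ha u hu) (hmemU b hb u' hu') (hmemU a ha v hv)
      (hmemU b hb v' hv') huu' hvv' hsum with ⟨h1, -⟩ | ⟨h1, -⟩
    · exact h1
    · exact absurd (hdisj' a ha b hb u hu (h1 ▸ hv')) hab
  have hWa : ∀ a ∈ B, ∀ f ∈ W, f ∈ soloSuppIn F ((E a : Finset ℕ) : Set ℕ) → f = 0 :=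
    fun a ha f hf hfs => hW a ha f hf fun k hk => hfs k fun hk' => hk (Finset.mem_coe.mp hk')
  -- the pairs
  set PIs := B.offDiag.filter (fun p : ι × ι => p.1 < p.2) with hPIs
  have hPI : ∀ p ∈ PIs, p.1 ∈ B ∧ p.2 ∈ B ∧ p.1 < p.2 := by
    intro p hp
    simp only [hPIs, Finset.mem_filter, Finset.mem_offDiag] at hp
    exact ⟨hp.1.1, hp.1.2.1, hp.2⟩
  have hpair : ∀ p : PIs, ∃ (m : ℕ) (f : {ij : Fin m × Fin m // ij.1 < ij.2} → F[X]),
      (E p.1.1).card + (E p.1.2).card ≤ m + finrank F W ∧ LinearIndependent F f ∧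
        (∀ k, f k ∈ Z) ∧ (∀ k, f k ∈ soloSuppIn F ((E p.1.1 + E p.1.2 : Finset ℕ) : Set ℕ)) := by
    intro p
    obtain ⟨ha, hb, hlt⟩ := hPI p.1 p.2
    exact solo_pencil_pair hZ1 hZ2 (fun e he => hXN _ ha e he) (fun e he => hXN _ hb e he)
      (hSin _ ha _ hb (ne_of_lt hlt)) (hWa _ ha) (hWa _ hb)
      (xa := fun e : ↥(E p.1.1) => x p.1.1 e) (wa := fun e : ↥(E p.1.1) => w p.1.1 e)
      (xb := fun e : ↥(E p.1.2) => x p.1.2 e) (wb := fun e : ↥(E p.1.2) => w p.1.2 e)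
      (fun e => hxW _ ha e e.2) (fun e => hwW _ ha e e.2) (fun e => hxW _ hb e e.2)
      (fun e => hwW _ hb e e.2) (fun e => hqx _ ha e e.2) (fun e => hqx _ hb e e.2)
  choose m f hmdim hli hfZ hfsupp using hpair
  -- value-sum sets of distinct pairs are disjoint (Sidon across pairs)
  have hSacross : ∀ i p : PIs, i ≠ p →
      (((E i.1.1 + E i.1.2 : Finset ℕ)) : Set ℕ) ⊆ (((E p.1.1 + E p.1.2 : Finset ℕ) : Set ℕ))ᶜ := by
    intro i p hip n hni hnp
    rw [Finset.mem_coe, Finset.mem_add] at hni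
    rw [Finset.mem_coe, Finset.mem_add] at hnp
    obtain ⟨u, hu, u', hu', hn⟩ := hni
    obtain ⟨v, hv, v', hv', hn'⟩ := hnp
    obtain ⟨ha, hb, hlt⟩ := hPI i.1 i.2
    obtain ⟨ha', hb', hlt'⟩ := hPI p.1 p.2
    have huu' : u ≠ u' := fun h => (ne_of_lt hlt) (hdisj' _ ha _ hb u hu (h ▸ hu'))
    have hvv' : v ≠ v' := fun h => (ne_of_lt hlt') (hdisj' _ ha' _ hb' v hv (h ▸ hv'))
    rcases hfree.sidon hK hh (hmemU _ ha u hu) (hmemU _ hb u' hu') (hmemU _ ha' v hv)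
      (hmemU _ hb' v' hv') huu' hvv' (hn.trans hn'.symm) with ⟨h1, h2⟩ | ⟨h1, h2⟩
    · apply hip
      have e1 : i.1.1 = p.1.1 := hdisj' _ ha _ ha' u hu (h1 ▸ hv)
      have e2 : i.1.2 = p.1.2 := hdisj' _ hb _ hb' u' hu' (h2 ▸ hv')
      exact Subtype.ext (Prod.ext e1 e2)
    · have e1 : i.1.1 = p.1.2 := hdisj' _ ha _ hb' u hu (h1 ▸ hv')
      have e2 : i.1.2 = p.1.1 := hdisj' _ hb _ ha' u' hu' (h2 ▸ hv)
      rw [e1, e2] at hlt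
      exact absurd (lt_trans hlt hlt') (lt_irrefl _)
  -- all wedges together are independent
  have hglob : LinearIndependent F
      (fun jk : (Σ p : PIs, {ij : Fin (m p) × Fin (m p) // ij.1 < ij.2}) => f jk.1 jk.2) := by
    apply linearIndependent_iUnion_finite hli
    intro p t _ hpt
    have h1 : Submodule.span F (Set.range (f p)) ≤
        soloSuppIn F (((E p.1.1 + E p.1.2 : Finset ℕ)) : Set ℕ) :=
      Submodule.span_le.mpr (by rintro _ ⟨k, rfl⟩; exact hfsupp p k)
    have h2 : (⨆ i ∈ t, Submodule.span F (Set.range (f i))) ≤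
        soloSuppIn F ((((E p.1.1 + E p.1.2 : Finset ℕ)) : Set ℕ))ᶜ := by
      refine iSup₂_le fun i hi => ?_
      have hip : i ≠ p := fun h => hpt (h ▸ hi)
      refine le_trans (Submodule.span_le.mpr ?_) (soloSuppIn_mono (hSacross i p hip))
      rintro _ ⟨k, rfl⟩
      exact hfsupp i k
    exact (soloSuppIn_disjoint_compl _).mono h1 h2
  have hcard := finrank_span_eq_card hglob
  rw [Fintype.card_sigma] at hcard
  simp only [solo_card_ltPairs] at hcard
  have hle : Submodule.span F (Set.range
      (fun jk : (Σ p : PIs, {ij : Fin (m p) × Fin (m p) // ij.1 < ij.2}) => f jk.1 jk.2)) ≤ Z :=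
    Submodule.span_le.mpr (by rintro _ ⟨⟨p, k⟩, rfl⟩; exact hfZ p k)
  have hfin := Submodule.finrank_mono hle
  rw [hcard] at hfin
  -- `dim Z ≤ s² + s Σ |E a|`
  have hZcard : finrank F Z ≤ s ^ 2 + s * ∑ a ∈ B, (E a).card := by
    have h1 : finrank F Z ≤ (bWf * bWf ∪ Mf * bWf).card :=
      finrank_span_finset_le_card (R := F) (bWf * bWf ∪ Mf * bWf)
    have h2 : bWf.card ≤ s := by
      refine Finset.card_image_le.trans ?_
      simp [hs]
    have h3 : Mf.card ≤ ∑ a ∈ B, (E a).card :=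
      Finset.card_image_le.trans Finset.card_biUnion_le
    calc finrank F Z ≤ (bWf * bWf ∪ Mf * bWf).card := h1
      _ ≤ (bWf * bWf).card + (Mf * bWf).card := Finset.card_union_le _ _
      _ ≤ bWf.card * bWf.card + Mf.card * bWf.card :=
          add_le_add Finset.card_mul_le Finset.card_mul_le
      _ ≤ s * s + (∑ a ∈ B, (E a).card) * s :=
          add_le_add (Nat.mul_le_mul h2 h2) (Nat.mul_le_mul h3 h2)
      _ = s ^ 2 + s * ∑ a ∈ B, (E a).card := by ring
  -- compare term by term
  calc ∑ p ∈ PIs, ((E p.1).card + (E p.2).card - s).choose 2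
      = ∑ p : PIs, ((E p.1.1).card + (E p.1.2).card - s).choose 2 := (Finset.sum_coe_sort _ _).symm
    _ ≤ ∑ p : PIs, (m p).choose 2 := Finset.sum_le_sum fun p _ =>
          Nat.choose_le_choose 2 (by have := hmdim p; omega)
    _ ≤ finrank F Z := hfin
    _ ≤ s ^ 2 + s * ∑ a ∈ B, (E a).card := hZcard

/-- `C(|B|,2)` is at most the number of ordered pairs `a < b` in `B` (in fact equal). -/
theorem solo_choose_two_le_card_ltPairs {ι : Type*} [LinearOrder ι] (B : Finset ι) :
    B.card.choose 2 ≤ (B.offDiag.filter (fun p : ι × ι => p.1 < p.2)).card := by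
  classical
  rw [← Finset.card_powersetCard 2 B]
  refine Finset.card_le_card_of_surjOn (fun p : ι × ι => ({p.1, p.2} : Finset ι)) ?_
  intro t ht
  rw [Finset.mem_coe, Finset.mem_powersetCard] at ht
  obtain ⟨a, b, hab, rfl⟩ := Finset.card_eq_two.mp ht.2
  have ha : a ∈ B := ht.1 (by simp)
  have hb : b ∈ B := ht.1 (by simp)
  rcases lt_or_gt_of_ne hab with hlt | hlt
  · exact ⟨(a, b), by simp [Finset.mem_offDiag, ha, hb, hab, hlt], rfl⟩
  · exact ⟨(b, a), by simp [Finset.mem_offDiag, ha, hb, hab.symm, hlt], Finset.pair_comm b a⟩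

/-- **Big pencils are few.**  Under the hypotheses of `soloInformed_pencilGirth`, if
every hub carries at least `(s+d)/2` and at most `R` values, then
`C(|B|,2)·C(d,2) ≤ s² + s·(|B|·R)`. -/
theorem soloInformed_pencilGirth_few {F : Type*} [Field F] {ι : Type*} [LinearOrder ι]
    (B : Finset ι) (W : Submodule F F[X]) [FiniteDimensional F W] (q : ι → F[X])
    (E : ι → Finset ℕ) {K h : ℕ} (hK : 4 ≤ K) (hh : 1 ≤ h)
    (hfree : SoloNatFree K h (B.biUnion E))
    (hdisj : ∀ a ∈ B, ∀ b ∈ B, a ≠ b → Disjoint (E a) (E b))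
    (hW : ∀ a ∈ B, ∀ f ∈ W, (∀ k ∉ E a, f.coeff k = 0) → f = 0)
    (hreal : ∀ a ∈ B, ∀ e ∈ E a, ∃ x ∈ W, ∃ w ∈ W, q a * x = w + X ^ e)
    {d R : ℕ} (hbig : ∀ a ∈ B, finrank F W + d ≤ 2 * (E a).card)
    (hR : ∀ a ∈ B, (E a).card ≤ R) :
    B.card.choose 2 * d.choose 2 ≤ finrank F W ^ 2 + finrank F W * (B.card * R) := by
  classical
  have hmain := soloInformed_pencilGirth B W q E hK hh hfree hdisj hW hreal
  set PIs := B.offDiag.filter (fun p : ι × ι => p.1 < p.2) with hPIs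
  have hcardPI : B.card.choose 2 ≤ PIs.card := solo_choose_two_le_card_ltPairs B
  have h1 : B.card.choose 2 * d.choose 2 ≤
      ∑ p ∈ PIs, ((E p.1).card + (E p.2).card - finrank F W).choose 2 := by
    calc B.card.choose 2 * d.choose 2 ≤ PIs.card * d.choose 2 := Nat.mul_le_mul_right _ hcardPI
      _ = ∑ p ∈ PIs, d.choose 2 := by rw [Finset.sum_const, smul_eq_mul]
      _ ≤ _ := Finset.sum_le_sum fun p hp => by
          have hp' : p.1 ∈ B ∧ p.2 ∈ B := by
            simp only [hPIs, Finset.mem_filter, Finset.mem_offDiag] at hp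
            exact ⟨hp.1.1, hp.1.2.1⟩
          apply Nat.choose_le_choose
          have := hbig _ hp'.1
          have := hbig _ hp'.2
          omega
  have h2 : ∑ a ∈ B, (E a).card ≤ B.card * R := by
    calc ∑ a ∈ B, (E a).card ≤ ∑ a ∈ B, R := Finset.sum_le_sum hR
      _ = B.card * R := by rw [Finset.sum_const, smul_eq_mul]
  calc B.card.choose 2 * d.choose 2 ≤ _ := h1
    _ ≤ finrank F W ^ 2 + finrank F W * ∑ a ∈ B, (E a).card := hmain
    _ ≤ finrank F W ^ 2 + finrank F W * (B.card * R) :=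
        Nat.add_le_add_left (Nat.mul_le_mul_left _ h2) _

end Summit.ValiantsHypothesis.ValiantsHypothesis.Theorems
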